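import Mathlib.Combinatorics.SimpleGraph.Paths
import Mathlib.Combinatorics.SimpleGraph.Connectivity.Connected
import Mathlib.Combinatorics.SimpleGraph.Finite
import Mathlib.Analysis.Normed.Group.Basic
import Mathlib.Topology.Instances.ENNReal.Lemmas
import HarnessLib

/-!
# Conformal removability: oscillation along chains (the "no cube twice" step)

Support for the proof of `JonesSmirnov2000_frontier_of_isHolderDomain` (Jones–Smirnov 2000,
Cor. 2; `ConformalRemovability.lean`). In the proof of Proposition 1 (P. W. Jones,
S. K. Smirnov, Ark. Mat. 38 (2000), pp. 271–272) the difference `|f(x_j) - f(y_j)|` is bounded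
by summing `|f(Q) - f(Q')| ≤ C(|∇f|(Q) l(Q) + |∇f|(Q') l(Q'))` along chains of adjacent Whitney
cubes, and then "for the purpose of estimating `|f(x_j) - f(y_j)|` we can assume that no cube
appears twice in the sums" (p. 271 bottom – p. 272 top: two chains through a common cube are
spliced into one). In graph language: along a walk whose steps cost `c(a) + c(b)` (vertex
charges) plus `e(a, b)` (edge charges), the cheapest connection is a simple path, which uses
every vertex and every edge at most once. This file proves that accounting once and for all:

* `enorm_sub_add_le_of_support_nodup` — along a walk with no repeated vertex,
  `‖f u - f v‖ + c u + c v ≤ 2 Σ_{vertices of the walk} c + Σ_{edges of the walk} e`;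
* `enorm_sub_le_of_reachable` — hence, in a finite graph, `‖f u - f v‖ ≤ 2 Σ_V c + Σ_E e`
  for all `u`, `v` in the same component (Mathlib's `SimpleGraph.Walk.bypass` extracts the
  simple path).

Values `f` live in any normed group, charges in `ℝ≥0∞` (they will be Dirichlet integrals
`(∫∫_{B} ‖F'‖²)^{1/2}` of a conformal map over dilated Whitney discs, and integrals of `‖F'‖`
over gaps of `K` on a line).

## References

* [JonesSmirnov2000] P. W. Jones, S. K. Smirnov, *Removability theorems for Sobolev functions and
  quasiconformal maps*, Ark. Mat. 38 (2000) 263–279, §2, pp. 271–272.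
-/

noncomputable section

open scoped ENNReal

namespace Literature.Probability.RandomPlanarGeometry

variable {V : Type*} {G : SimpleGraph V} {E : Type*} [NormedAddCommGroup E]

/-- **Oscillation along a simple chain.** If adjacent vertices satisfy
`‖f a - f b‖ ≤ c a + c b + e {a, b}`, then along a walk `p` from `u` to `v` without repeated
vertices, `‖f u - f v‖ + c u + c v ≤ 2 Σ_{w ∈ p} c w + Σ_{edges of p} e` (each vertex is charged
at most twice, each edge once; the extra `c u + c v` on the left makes the induction close).
(Jones–Smirnov 2000, p. 271: the chain estimate with "no cube appears twice".)
[cite: JonesSmirnov2000, §2 pp. 271–272] -/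
theorem enorm_sub_add_le_of_support_nodup [DecidableEq V] (f : V → E) (c : V → ℝ≥0∞)
    (e : Sym2 V → ℝ≥0∞) (hadj : ∀ a b, G.Adj a b → ‖f a - f b‖ₑ ≤ c a + c b + e s(a, b)) :
    ∀ {u v : V} (p : G.Walk u v), p.support.Nodup →
      ‖f u - f v‖ₑ + c u + c v ≤
        2 * ∑ w ∈ p.support.toFinset, c w + ∑ d ∈ p.edges.toFinset, e d
  | u, _, .nil, _ => by
    rw [sub_self, ← ofReal_norm, norm_zero, ENNReal.ofReal_zero, zero_add, two_mul]
    simp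
  | u, v, .cons (v := x) h q, hnd => by
    rw [SimpleGraph.Walk.support_cons, List.nodup_cons] at hnd
    obtain ⟨hu, hq⟩ := hnd
    have ih := enorm_sub_add_le_of_support_nodup f c e hadj q hq
    have hux : s(u, x) ∉ q.edges := fun he => hu (q.fst_mem_support_of_mem_edges he)
    rw [SimpleGraph.Walk.support_cons, SimpleGraph.Walk.edges_cons, List.toFinset_cons,
      List.toFinset_cons, Finset.sum_insert (by simpa using hu),
      Finset.sum_insert (by simpa using hux)]
    have htri : ‖f u - f v‖ₑ ≤ ‖f u - f x‖ₑ + ‖f x - f v‖ₑ := by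
      have := edist_triangle (f u) (f x) (f v)
      simpa only [edist_eq_enorm_sub] using this
    calc ‖f u - f v‖ₑ + c u + c v
        ≤ (‖f u - f x‖ₑ + ‖f x - f v‖ₑ) + c u + c v := by gcongr
      _ ≤ (c u + c x + e s(u, x) + ‖f x - f v‖ₑ) + c u + c v := by gcongr; exact hadj u x h
      _ = 2 * c u + e s(u, x) + (‖f x - f v‖ₑ + c x + c v) := by ring
      _ ≤ 2 * c u + e s(u, x) +
          (2 * ∑ w ∈ q.support.toFinset, c w + ∑ d ∈ q.edges.toFinset, e d) := by gcongr
      _ = 2 * (c u + ∑ w ∈ q.support.toFinset, c w) +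
          (e s(u, x) + ∑ d ∈ q.edges.toFinset, e d) := by ring

/-- **The cheapest connection is a simple path.** In a finite graph whose adjacent vertices
satisfy `‖f a - f b‖ ≤ c a + c b + e {a, b}`, any two vertices of the same component satisfy
`‖f u - f v‖ ≤ 2 Σ_{all vertices} c + Σ_{all edges} e` — every vertex charge is paid at most
twice and every edge charge at most once, however long the given walk (Mathlib's
`SimpleGraph.Walk.bypass`). (Jones–Smirnov 2000, pp. 271–272, "no cube appears twice".)
[cite: JonesSmirnov2000, §2 pp. 271–272] -/
theorem enorm_sub_le_of_reachable [Fintype V] [DecidableEq V] [DecidableRel G.Adj] (f : V → E)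
    (c : V → ℝ≥0∞) (e : Sym2 V → ℝ≥0∞)
    (hadj : ∀ a b, G.Adj a b → ‖f a - f b‖ₑ ≤ c a + c b + e s(a, b)) {u v : V}
    (h : G.Reachable u v) :
    ‖f u - f v‖ₑ ≤ 2 * ∑ w, c w + ∑ d ∈ G.edgeFinset, e d := by
  obtain ⟨p⟩ := h
  have hp := enorm_sub_add_le_of_support_nodup f c e hadj p.bypass
    p.bypass_isPath.support_nodup
  calc ‖f u - f v‖ₑ ≤ ‖f u - f v‖ₑ + c u + c v := by rw [add_assoc]; exact le_self_add
    _ ≤ _ := hp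
    _ ≤ 2 * ∑ w, c w + ∑ d ∈ G.edgeFinset, e d := by
      gcongr
      · exact Finset.subset_univ _
      · intro d hd
        rw [SimpleGraph.mem_edgeFinset]
        exact p.bypass.edges_subset_edgeSet (List.mem_toFinset.1 hd)

end Literature.Probability.RandomPlanarGeometry
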